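import Literature.AlgebraicGeometry.Motives.HodgeLieTimesCMSummand
import Literature.AlgebraicGeometry.Motives.HodgeLieRigidTimesRankOne
import HarnessLib

/-!
# `Θ`-rigidity is inherited along an ABELIAN summand which is twisted-rigid for the slope of the other summand
# (Moonen–Zarhin 1999 §3 (3.1), Lemma (3.6), Prop. (3.8): Goursat over a torus factor whose character does not resonate)

Family `hodge`, layer `Literature/AlgebraicGeometry/Motives`; THEOREMS ONLY (no definition, no named fact).  Written for the cell
`pub-hodgecm2` (COR-CM), seat `b27` gen 51 (count-neutral Mumford–Tate-rank ladder: towers `A × E₀ × ⋯ × E_m` of CM elliptic curves).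
Sequel of `Motives/HodgeLieTimesCMSummand` (the SPLITTING `𝔥(H₁ ⊕ H₂) = 𝔥(H₁) × 𝔥(H₂)` along an abelian, twisted-rigid summand) and of
`Motives/HodgeLieRigidTimesRankOne{,Family}` (`Θ`-RIGIDITY passes from `H₁` to `H₁ ⊕ H₂` when `𝔥(H₂)` has rank ONE); here `𝔥(H₂)` is
abelian of ANY rank.

SETTING.  `H ≅ H₁ ⊕ H₂` (`ι_i`, `π_i`, `π_i ι_i = id`, `ι₁π₁ + ι₂π₂ = id`), weight `n`; a polarization `ψ₁` of `H₁`; `φ₁ ∈ End_Hdg(H₁)` with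
(Z₁) every `ψ₁`-skew central Hodge endomorphism of `H₁` in `ℚφ₁` (e.g. `H₁ = H¹A`, `End⁰A` imaginary quadratic); (AB₂) `𝔥(H₂)` abelian;
(R₁) `H₁` `Θ`-RIGID (every bracket-closed rational `𝔞₁ ⊆ 𝔥(H₁)` with a Hodge operator in `𝔞₁ ⊗ ℂ` is `𝔥(H₁)`); (TR₂) `H₂` TWISTED-RIGID
for the slope of `H₁`: `tr(φ₁²)·Θ₂ − tr(Θ₁φ₁,ℂ)·(y₀)_ℂ ∈ K_ℂ ⟹ 𝔥(H₂) ≤ K` for rational `K ≤ 𝔥(H₂)`, `y₀ ∈ 𝔥(H₂)`.  `r_i X = π_i X ι_i`.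

§1 **`rigid_of_abelian_of_twistedRigid_of_rigid`** — `H` IS `Θ`-RIGID.  For `𝔞 ⊆ 𝔥(H)` bracket-closed with a Hodge operator `Θ ∈ 𝔞 ⊗ ℂ`:
(1) `r₁(𝔞) = 𝔥(H₁)` by (R₁) (`map_restrict_eq_hodgeLie_of_rigid`); (2) a bracket of lifts `X, Y ∈ 𝔞` of `x, y ∈ 𝔥(H₁)` has zero second
block (AB₂), so it IS the corner `ι₁[x,y]π₁`: `ι₁ 𝔡₁ π₁ ⊆ 𝔞`, `𝔡₁ = [𝔥(H₁),𝔥(H₁)]`; (3) Deligne `𝔥(H₁) = 𝔷₁ ⊕ 𝔡₁`, `𝔷₁ ⊆ ℚφ₁` (Z₁), so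
`𝔞 ⊆ ℚz₀ + ι₁𝔡₁π₁ + Z₀` with `Z₀ = 𝔞 ∩ ker r₁`, `z₀ ∈ 𝔞` over `φ₁` (or `z₀ = 0` if `φ₁ ∉ 𝔥(H₁)`); (4) write `Θ = λz₀,ℂ + s + k`: the trace
functional `Z ↦ tr(r₁(Z)φ₁,ℂ)` kills `s`, `k` and gives `tr(Θ₁φ₁,ℂ) = λx₀tr(φ₁²)`; the block map `r₂` kills `s` (`π₂ι₁ = 0`) and gives
`Θ₂ − λx₀(y₀)_ℂ ∈ K_ℂ`, `K = r₂Z₀`, `r₂z₀ = x₀y₀`; so `tr(φ₁²)Θ₂ − tr(Θ₁φ₁,ℂ)(y₀)_ℂ ∈ K_ℂ` and `𝔥(H₂) ≤ K` by (TR₂); (5) the second corners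
`ι₂yπ₂`, `y ∈ 𝔥(H₂) ⊆ r₂Z₀`, are elements of `Z₀ ⊆ 𝔞`, and `X = X' − ι₂(r₂X')π₂ + ι₂(r₂X)π₂` for `X' ∈ 𝔞` over `r₁X`.  So `𝔥(H) ⊆ 𝔞`.
The induction-free form of Moonen–Zarhin's argument for `Hg(A × E₀ × ⋯ × E_m)`: the torus `Hg(⨁E)` enters only through (TR₂)
(`CorCM/MumfordTateRankCMCurvesProductTheta`), and the rigid-factor monotonicity of `CorCM/MumfordTateRankRigidMonotone` applies to the tower.
§2 **`rigid_of_rigid_of_finrank_le`** — the ABSORBED case: `H₁` `Θ`-rigid and `dim 𝔥(H) ≤ dim 𝔥(H₁)` (`r₁ : 𝔥(H) ≅ 𝔥(H₁)`, e.g. `X₁ × E`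
with `End⁰E ≅ End⁰X₁`, Moonen–Zarhin (0.1)(4)(a)) ⟹ `H` `Θ`-rigid.

## References
* [MoonenZarhin1999LowDim] B. Moonen, Yu. G. Zarhin, *Hodge classes on abelian varieties of low dimension*, Math. Ann. 315 (1999), §3 (3.1),
  Lemma (3.6), Prop. (3.8) [corpus: paper:arxiv-math_9901113 pp. 6–7]. [cite: MoonenZarhin1999LowDim, §3 (3.1), (3.6) and (3.8)]
* [Deligne1982HodgeCycles] P. Deligne, *Hodge cycles on abelian varieties*, LNM 900 (1982), I §3.1, Prop. 3.4 and Prop. 3.6.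
  [cite: Deligne1982HodgeCycles, I §3 Prop. 3.6]
* [Hazama1983] F. Hazama, *Algebraic cycles on abelian varieties with many real endomorphisms*, Tôhoku Math. J. 35 (1983), Lemma (3.1) (Goursat).
  [cite: Hazama1983, Lemma (3.1)]
* [Humphreys1972] J. E. Humphreys, GTM 9, §5.1, §19.1 (`L = Z(L) ⊕ [L, L]`). [cite: Humphreys1972, §19.1]
-/

noncomputable section

open scoped TensorProduct

namespace Literature.AlgebraicGeometry.Motives

namespace HodgeStructure

universe u

variable {V₁ : Type u} [AddCommGroup V₁] [Module ℚ V₁] [Module.Finite ℚ V₁]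
  {V₂ : Type u} [AddCommGroup V₂] [Module ℚ V₂] [Module.Finite ℚ V₂]
  {V : Type u} [AddCommGroup V] [Module ℚ V] [Module.Finite ℚ V] [HodgeTensorFacts.{u, u}] {n : ℤ}
  {H₁ : HodgeStructure V₁ n} {H₂ : HodgeStructure V₂ n} {H : HodgeStructure V n}
  (ι₁ : Hom H₁ H) (π₁ : Hom H H₁) (ι₂ : Hom H₂ H) (π₂ : Hom H H₂)
  (hπι₁ : ∀ v, π₁.toLinearMap (ι₁.toLinearMap v) = v) (hπι₂ : ∀ v, π₂.toLinearMap (ι₂.toLinearMap v) = v)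
  (hsum : ∀ v, ι₁.toLinearMap (π₁.toLinearMap v) + ι₂.toLinearMap (π₂.toLinearMap v) = v)
  (hrig₁ : ∀ 𝔞 : Submodule ℚ (Module.End ℚ V₁), 𝔞 ≤ H₁.hodgeLie →
      (∀ X ∈ 𝔞, ∀ Y ∈ 𝔞, X * Y - Y * X ∈ 𝔞) →
      (∃ Θ ∈ Submodule.span ℂ ((fun X : Module.End ℚ V₁ => X.baseChange ℂ) '' (𝔞 : Set (Module.End ℚ V₁))),
        ∀ p, ∀ x ∈ H₁.piece p (n - p), Θ x = ((2 * p - n : ℤ) : ℂ) • x) → H₁.hodgeLie ≤ 𝔞)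

/-! ## §0 Plumbing -/

omit [Module.Finite ℚ V] [HodgeTensorFacts.{u, u}] in
/-- Base change of a rational multiple: `(c • T)_ℂ = c • T_ℂ`. [folklore] -/
private theorem baseChange_ratCast_smul_tr (c : ℚ) (T : Module.End ℚ V) :
    (c • T).baseChange ℂ = (c : ℂ) • T.baseChange ℂ := by
  refine TensorProduct.AlgebraTensorModule.ext fun z v => ?_
  rw [LinearMap.baseChange_tmul, LinearMap.smul_apply, LinearMap.smul_apply, LinearMap.baseChange_tmul,
    TensorProduct.smul_tmul', ← TensorProduct.smul_tmul, Rat.smul_def, smul_eq_mul]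

omit [Module.Finite ℚ V] [HodgeTensorFacts.{u, u}] in
/-- `(𝔞 ⊔ 𝔟)_ℂ ≤ 𝔞_ℂ ⊔ 𝔟_ℂ` for the complex spans. [folklore] -/
private theorem spanC_sup_le_tr (𝔞 𝔟 : Submodule ℚ (Module.End ℚ V)) : spanC (𝔞 ⊔ 𝔟) ≤ spanC 𝔞 ⊔ spanC 𝔟 := by
  change Submodule.span ℂ _ ≤ _
  rw [Submodule.span_le]
  rintro _ ⟨X, hX, rfl⟩
  obtain ⟨a, ha, b, hb, rfl⟩ := Submodule.mem_sup.1 hX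
  change (a + b).baseChange ℂ ∈ spanC 𝔞 ⊔ spanC 𝔟
  rw [LinearMap.baseChange_add]
  exact Submodule.add_mem _ (Submodule.mem_sup_left (baseChange_mem_spanC ha))
    (Submodule.mem_sup_right (baseChange_mem_spanC hb))

omit [Module.Finite ℚ V] [HodgeTensorFacts.{u, u}] in
/-- `(ℚ z)_ℂ ≤ ℂ z_ℂ`. [folklore] -/
private theorem spanC_span_singleton_le_tr (z : Module.End ℚ V) : spanC (ℚ ∙ z) ≤ ℂ ∙ z.baseChange ℂ := by
  change Submodule.span ℂ _ ≤ _
  rw [Submodule.span_le]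
  rintro _ ⟨X, hX, rfl⟩
  obtain ⟨q, rfl⟩ := Submodule.mem_span_singleton.1 hX
  change (q • z).baseChange ℂ ∈ ℂ ∙ z.baseChange ℂ
  rw [baseChange_ratCast_smul_tr]
  exact Submodule.smul_mem _ _ (Submodule.mem_span_singleton_self _)

omit [Module.Finite ℚ V₁] [Module.Finite ℚ V₂] [Module.Finite ℚ V] [HodgeTensorFacts.{u, u}] in
include hπι₁ hπι₂ hsum in
/-- `π₂ ι₁ = 0` for a decomposition `ι₁ π₁ + ι₂ π₂ = id` with `π_i ι_i = id`. [folklore] -/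
private theorem proj₂_incl₁_eq_zero_tr : π₂.toLinearMap ∘ₗ ι₁.toLinearMap = 0 := by
  refine LinearMap.ext fun v => ?_
  have h := congrArg π₂.toLinearMap (hsum (ι₁.toLinearMap v))
  rw [map_add, hπι₁ v, hπι₂] at h
  rw [LinearMap.comp_apply, LinearMap.zero_apply]
  exact add_eq_left.1 h

omit [Module.Finite ℚ V] [HodgeTensorFacts.{u, u}] in
/-- A `ℂ`-linear map sending `X_ℂ` into `N` for all `X ∈ 𝔤` sends `𝔤_ℂ` into `N`. [folklore] -/
private theorem map_spanC_mem_tr {W : Type*} [AddCommGroup W] [Module ℂ W] (𝔤 : Submodule ℚ (Module.End ℚ V))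
    (f : Module.End ℂ (ℂ ⊗[ℚ] V) →ₗ[ℂ] W) (N : Submodule ℂ W) (h : ∀ X ∈ 𝔤, f (X.baseChange ℂ) ∈ N) :
    ∀ s ∈ spanC 𝔤, f s ∈ N := by
  have hle : spanC 𝔤 ≤ N.comap f := by
    change Submodule.span ℂ _ ≤ _
    rw [Submodule.span_le]
    rintro _ ⟨X, hX, rfl⟩
    exact h X hX
  exact fun s hs => hle hs

/-- **`tr(d φ₁) = 0` for `d` in the derived algebra `[𝔥(H₁), 𝔥(H₁)]` and a Hodge endomorphism `φ₁`** (`φ₁` commutes with `𝔥(H₁)`;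
cyclicity of the trace). [cite: Humphreys1972, §5.1] [cite: Deligne1982HodgeCycles, I §3 Prop. 3.6] -/
theorem trace_mul_eq_zero_of_mem_derived_of_mem_endAlg {φ₁ : Module.End ℚ V₁} (hφ₁E : φ₁ ∈ H₁.endAlg)
    {d : Module.End ℚ V₁} (hd : d ∈ Submodule.span ℚ {B | ∃ X ∈ H₁.hodgeLie, ∃ Y ∈ H₁.hodgeLie, X * Y - Y * X = B}) :
    LinearMap.trace ℚ V₁ (d * φ₁) = 0 := by
  induction hd using Submodule.span_induction with
  | mem B hB =>
    obtain ⟨X, hX, Y, -, rfl⟩ := hB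
    have hXφ : X * φ₁ = φ₁ * X := commute_of_mem_hodgeLie H₁ hX ⟨φ₁, hφ₁E⟩
    rw [sub_mul, map_sub, mul_assoc Y X φ₁, hXφ, ← mul_assoc, LinearMap.trace_mul_comm ℚ (Y * φ₁) X, ← mul_assoc, sub_self]
  | zero => rw [zero_mul, map_zero]
  | add B B' _ _ hB hB' => rw [add_mul, map_add, hB, hB', add_zero]
  | smul c B _ hB => rw [smul_mul_assoc, map_smul, hB, smul_zero]

/-! ## §1 Rigidity is inherited along a twisted-rigid abelian summand -/

section Main

variable (ψ₁ : H₁.Polarization) {φ₁ : Module.End ℚ V₁} (hφ₁E : φ₁ ∈ H₁.endAlg)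
  (hZ₁ : ∀ a ∈ H₁.endAlg, (∀ b ∈ H₁.endAlg, a * b = b * a) →
    (∀ v w, ψ₁.form (a v) w + ψ₁.form v (a w) = 0) → ∃ x : ℚ, a = x • φ₁)
  (hab₂ : ∀ A ∈ H₂.hodgeLie, ∀ B ∈ H₂.hodgeLie, A * B = B * A)
  {Θ₁ : Module.End ℂ (ℂ ⊗[ℚ] V₁)} (hΘ₁ : ∀ p, ∀ x ∈ H₁.piece p (n - p), Θ₁ x = ((2 * p - n : ℤ) : ℂ) • x)
  {Θ₂ : Module.End ℂ (ℂ ⊗[ℚ] V₂)} (hΘ₂ : ∀ p, ∀ x ∈ H₂.piece p (n - p), Θ₂ x = ((2 * p - n : ℤ) : ℂ) • x)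
  (hrig : ∀ K : Submodule ℚ (Module.End ℚ V₂), K ≤ H₂.hodgeLie → ∀ y₀ ∈ H₂.hodgeLie,
    ((LinearMap.trace ℚ V₁ (φ₁ * φ₁) : ℚ) : ℂ) • Θ₂ - LinearMap.trace ℂ _ (Θ₁ * φ₁.baseChange ℂ) • y₀.baseChange ℂ ∈ spanC K →
      H₂.hodgeLie ≤ K)

include hπι₁ hπι₂ hsum hrig₁ ψ₁ hφ₁E hZ₁ hab₂ hΘ₁ hΘ₂ hrig in
/-- **`Θ`-rigidity is inherited along a twisted-rigid abelian summand.**  `H ≅ H₁ ⊕ H₂`; `H₁` `Θ`-rigid with `ψ₁`-skew centre of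
`End_Hdg(H₁)` inside `ℚφ₁`; `𝔥(H₂)` abelian and twisted-rigid for the slope of `H₁` (`tr(φ₁²)Θ₂ − tr(Θ₁φ₁)y₀ ∈ K_ℂ ⟹ 𝔥(H₂) ≤ K` for all
rational `K ≤ 𝔥(H₂)`, `y₀ ∈ 𝔥(H₂)`).  Then EVERY bracket-closed rational `𝔞 ⊆ 𝔥(H)` whose complex span contains a Hodge operator of `H`
is all of `𝔥(H)` — Goursat over the torus `Hg(X₂)`: `𝔞 ↠ 𝔥(H₁)` (rigidity), `𝔞 ⊇ ι₁[𝔥(H₁),𝔥(H₁)]π₁` (abelian second blocks), and the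
graph part over the centre `ℚφ₁` would be a resonance of the Hodge operator, excluded by the twisted rigidity.
[cite: MoonenZarhin1999LowDim, §3 (3.1), (3.6) and (3.8)] [cite: Deligne1982HodgeCycles, I §3 Prop. 3.6] [cite: Hazama1983, Lemma (3.1)] -/
theorem rigid_of_abelian_of_twistedRigid_of_rigid :
    ∀ 𝔞 : Submodule ℚ (Module.End ℚ V), 𝔞 ≤ H.hodgeLie →
      (∀ X ∈ 𝔞, ∀ Y ∈ 𝔞, X * Y - Y * X ∈ 𝔞) →
      (∃ Θ ∈ Submodule.span ℂ ((fun X : Module.End ℚ V => X.baseChange ℂ) '' (𝔞 : Set (Module.End ℚ V))),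
        ∀ p, ∀ x ∈ H.piece p (n - p), Θ x = ((2 * p - n : ℤ) : ℂ) • x) → H.hodgeLie ≤ 𝔞 := by
  classical
  intro 𝔞 h𝔞 hbr hΘex
  -- the rational block maps
  set r₁Q : Module.End ℚ V →ₗ[ℚ] Module.End ℚ V₁ :=
    (LinearMap.llcomp ℚ V₁ V V₁ π₁.toLinearMap).comp (LinearMap.lcomp ℚ V ι₁.toLinearMap) with hr₁Qdef
  have hr₁Q : ∀ X, r₁Q X = π₁.toLinearMap ∘ₗ X ∘ₗ ι₁.toLinearMap := fun X => rfl
  set r₂Q : Module.End ℚ V →ₗ[ℚ] Module.End ℚ V₂ :=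
    (LinearMap.llcomp ℚ V₂ V V₂ π₂.toLinearMap).comp (LinearMap.lcomp ℚ V ι₂.toLinearMap) with hr₂Qdef
  have hr₂Q : ∀ X, r₂Q X = π₂.toLinearMap ∘ₗ X ∘ₗ ι₂.toLinearMap := fun X => rfl
  have hπι₁' : π₁.toLinearMap ∘ₗ ι₁.toLinearMap = LinearMap.id := LinearMap.ext hπι₁
  have hπι₂' : π₂.toLinearMap ∘ₗ ι₂.toLinearMap = LinearMap.id := LinearMap.ext hπι₂
  have hπ₂ι₁ := proj₂_incl₁_eq_zero_tr ι₁ π₁ ι₂ π₂ hπι₁ hπι₂ hsum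
  -- first corners: `r₁ (ι₁ x π₁) = x`, `r₂ (ι₁ x π₁) = 0`
  have hr₁c₁ : ∀ x : Module.End ℚ V₁, r₁Q (ι₁.toLinearMap ∘ₗ x ∘ₗ π₁.toLinearMap) = x := fun x => by
    rw [hr₁Q]
    refine LinearMap.ext fun v => ?_
    simp only [LinearMap.comp_apply, hπι₁]
  have hr₂c₁ : ∀ x : Module.End ℚ V₁, r₂Q (ι₁.toLinearMap ∘ₗ x ∘ₗ π₁.toLinearMap) = 0 := fun x => by
    rw [hr₂Q, ← LinearMap.comp_assoc, ← LinearMap.comp_assoc, hπ₂ι₁, LinearMap.zero_comp, LinearMap.zero_comp]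
  -- (1) `r₁ 𝔞 = 𝔥(H₁)`
  have himg : 𝔞.map r₁Q = H₁.hodgeLie := map_restrict_eq_hodgeLie_of_rigid ι₁ π₁ hπι₁ hrig₁ 𝔞 h𝔞 hbr hΘex
  have hlift : ∀ x ∈ H₁.hodgeLie, ∃ X ∈ 𝔞, r₁Q X = x := fun x hx => Submodule.mem_map.1 (himg ▸ hx)
  -- (2) the first corners of the derived algebra `𝔡₁` lie in `𝔞`
  set 𝔡₁ : Submodule ℚ (Module.End ℚ V₁) :=
    Submodule.span ℚ {B | ∃ X ∈ H₁.hodgeLie, ∃ Y ∈ H₁.hodgeLie, X * Y - Y * X = B} with h𝔡₁def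
  have hbr₁ : ∀ x ∈ H₁.hodgeLie, ∀ y ∈ H₁.hodgeLie, ι₁.toLinearMap ∘ₗ (x * y - y * x) ∘ₗ π₁.toLinearMap ∈ 𝔞 := by
    intro x hx y hy
    obtain ⟨X, hX, hXx⟩ := hlift x hx
    obtain ⟨Y, hY, hYy⟩ := hlift y hy
    have hXY : X * Y - Y * X ∈ 𝔞 := hbr X hX Y hY
    -- second block of the bracket vanishes (abelian `𝔥(H₂)`), first block is `[x, y]`
    have h2 : π₂.toLinearMap ∘ₗ (X * Y - Y * X) ∘ₗ ι₂.toLinearMap = 0 := by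
      rw [LinearMap.sub_comp, LinearMap.comp_sub, restrict_mul ι₂ π₂ hπι₂ (h𝔞 hY), restrict_mul ι₂ π₂ hπι₂ (h𝔞 hX),
        hab₂ _ (comp_mem_hodgeLie_of_retract ι₂ π₂ hπι₂ (h𝔞 hX)) _ (comp_mem_hodgeLie_of_retract ι₂ π₂ hπι₂ (h𝔞 hY)), sub_self]
    have h1 : π₁.toLinearMap ∘ₗ (X * Y - Y * X) ∘ₗ ι₁.toLinearMap = x * y - y * x := by
      rw [LinearMap.sub_comp, LinearMap.comp_sub, restrict_mul ι₁ π₁ hπι₁ (h𝔞 hY), restrict_mul ι₁ π₁ hπι₁ (h𝔞 hX), ← hr₁Q, ← hr₁Q,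
        hXx, hYy]
    have heq := eq_sum_blocks_of_mem_hodgeLie ι₁ π₁ ι₂ π₂ hπι₁ hπι₂ hsum (h𝔞 hXY)
    rw [h2, h1, LinearMap.zero_comp, LinearMap.comp_zero, add_zero] at heq
    exact heq ▸ hXY
  have h𝔡₁𝔞 : ∀ d ∈ 𝔡₁, ι₁.toLinearMap ∘ₗ d ∘ₗ π₁.toLinearMap ∈ 𝔞 := by
    intro d hd
    induction hd using Submodule.span_induction with
    | mem B hB => obtain ⟨x, hx, y, hy, rfl⟩ := hB; exact hbr₁ x hx y hy
    | zero => rw [LinearMap.zero_comp, LinearMap.comp_zero]; exact Submodule.zero_mem _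
    | add B B' _ _ hB hB' => rw [LinearMap.add_comp, LinearMap.comp_add]; exact Submodule.add_mem _ hB hB'
    | smul c B _ hB => rw [LinearMap.smul_comp, LinearMap.comp_smul]; exact Submodule.smul_mem _ c hB
  -- the corner space `D = ι₁ 𝔡₁ π₁`
  set c₁ : Module.End ℚ V₁ →ₗ[ℚ] Module.End ℚ V :=
    (LinearMap.llcomp ℚ V V₁ V ι₁.toLinearMap).comp (LinearMap.lcomp ℚ V₁ π₁.toLinearMap) with hc₁def
  have hc₁ : ∀ x, c₁ x = ι₁.toLinearMap ∘ₗ x ∘ₗ π₁.toLinearMap := fun x => rfl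
  set D : Submodule ℚ (Module.End ℚ V) := 𝔡₁.map c₁ with hDdef
  -- (3) `Z₀ = 𝔞 ∩ ker r₁`, `K = r₂ Z₀ ≤ 𝔥(H₂)`
  set Z₀ : Submodule ℚ (Module.End ℚ V) := 𝔞 ⊓ LinearMap.ker r₁Q with hZ₀def
  have hZ₀𝔞 : Z₀ ≤ 𝔞 := fun z hz => (Submodule.mem_inf.1 hz).1
  have hZ₀1 : ∀ z ∈ Z₀, π₁.toLinearMap ∘ₗ z ∘ₗ ι₁.toLinearMap = 0 := fun z hz => by
    rw [← hr₁Q]; exact LinearMap.mem_ker.1 (Submodule.mem_inf.1 hz).2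
  set K : Submodule ℚ (Module.End ℚ V₂) := Z₀.map r₂Q with hKdef
  have hK𝔥 : K ≤ H₂.hodgeLie := by
    rintro _ ⟨z, hz, rfl⟩
    exact hr₂Q z ▸ comp_mem_hodgeLie_of_retract ι₂ π₂ hπι₂ (h𝔞 (hZ₀𝔞 hz))
  -- the centre of `𝔥(H₁)` lies on `ℚφ₁`
  have hcen : ∀ z ∈ H₁.hodgeLie ⊓ Subalgebra.toSubmodule H₁.endAlg, ∃ c : ℚ, z = c • φ₁ := by
    intro z hz
    obtain ⟨hz𝔥, hzE⟩ := Submodule.mem_inf.1 hz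
    rw [Subalgebra.mem_toSubmodule] at hzE
    exact hZ₁ z hzE (fun b hb => commute_of_mem_hodgeLie H₁ hz𝔥 ⟨b, hb⟩) (form_apply_add_eq_zero_of_mem_hodgeLie ψ₁ hz𝔥)
  -- (3') the presentation `𝔞 ≤ ℚ z₀ + D + Z₀` with `r₁ z₀ = x₀ φ₁`, `r₂ z₀ = x₀ y₀`, `z₀ ∈ 𝔞`, `y₀ ∈ 𝔥(H₂)`
  obtain ⟨z₀, x₀, y₀, hz₀𝔞, hy₀, hx₀, hxy₀, hle⟩ : ∃ z₀ : Module.End ℚ V, ∃ x₀ : ℚ, ∃ y₀ : Module.End ℚ V₂,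
      z₀ ∈ 𝔞 ∧ y₀ ∈ H₂.hodgeLie ∧ π₁.toLinearMap ∘ₗ z₀ ∘ₗ ι₁.toLinearMap = x₀ • φ₁ ∧
        π₂.toLinearMap ∘ₗ z₀ ∘ₗ ι₂.toLinearMap = x₀ • y₀ ∧ 𝔞 ≤ ((ℚ ∙ z₀) ⊔ D) ⊔ Z₀ := by
    -- decomposition of a first block along Deligne's `𝔥(H₁) = 𝔷₁ ⊕ 𝔡₁`
    have hdec : ∀ X ∈ 𝔞, ∃ c : ℚ, ∃ d ∈ 𝔡₁, c • φ₁ ∈ H₁.hodgeLie ∧ r₁Q X = c • φ₁ + d := by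
      intro X hX
      have hx : r₁Q X ∈ H₁.hodgeLie := by rw [hr₁Q]; exact comp_mem_hodgeLie_of_retract ι₁ π₁ hπι₁ (h𝔞 hX)
      rw [← AnyWeight.hodgeLie_center_sup_derived_eq H₁ ψ₁] at hx
      obtain ⟨z, hz, d, hd, hzd⟩ := Submodule.mem_sup.1 hx
      obtain ⟨c, rfl⟩ := hcen z hz
      exact ⟨c, d, hd, (Submodule.mem_inf.1 hz).1, hzd.symm⟩
    by_cases hφ : φ₁ ∈ H₁.hodgeLie
    · obtain ⟨z₀, hz₀, hz₀φ⟩ := hlift φ₁ hφ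
      refine ⟨z₀, 1, π₂.toLinearMap ∘ₗ z₀ ∘ₗ ι₂.toLinearMap, hz₀,
        comp_mem_hodgeLie_of_retract ι₂ π₂ hπι₂ (h𝔞 hz₀), by rw [← hr₁Q, hz₀φ, one_smul], by rw [one_smul], ?_⟩
      intro X hX
      obtain ⟨c, d, hd, -, hXcd⟩ := hdec X hX
      have hrest : X - c • z₀ - ι₁.toLinearMap ∘ₗ d ∘ₗ π₁.toLinearMap ∈ Z₀ := by
        refine Submodule.mem_inf.2 ⟨Submodule.sub_mem _ (Submodule.sub_mem _ hX (Submodule.smul_mem _ _ hz₀)) (h𝔡₁𝔞 d hd), ?_⟩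
        rw [LinearMap.mem_ker, map_sub, map_sub, map_smul, hXcd, hz₀φ, hr₁c₁, add_sub_cancel_left, sub_self]
      have heq : X = (c • z₀ + ι₁.toLinearMap ∘ₗ d ∘ₗ π₁.toLinearMap) + (X - c • z₀ - ι₁.toLinearMap ∘ₗ d ∘ₗ π₁.toLinearMap) := by
        abel
      rw [heq]
      exact Submodule.add_mem _ (Submodule.mem_sup_left (Submodule.add_mem _
        (Submodule.mem_sup_left (Submodule.smul_mem _ _ (Submodule.mem_span_singleton_self _)))
        (Submodule.mem_sup_right ⟨d, hd, rfl⟩))) (Submodule.mem_sup_right hrest)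
    · refine ⟨0, 0, 0, Submodule.zero_mem _, Submodule.zero_mem _,
        by rw [LinearMap.zero_comp, LinearMap.comp_zero, zero_smul], by rw [LinearMap.zero_comp, LinearMap.comp_zero, smul_zero], ?_⟩
      intro X hX
      obtain ⟨c, d, hd, hcφ, hXcd⟩ := hdec X hX
      have hc0 : c = 0 := by
        by_contra hc
        apply hφ
        rw [show φ₁ = c⁻¹ • (c • φ₁) by rw [smul_smul, inv_mul_cancel₀ hc, one_smul]]
        exact Submodule.smul_mem _ _ hcφ
      rw [hc0, zero_smul, zero_add] at hXcd
      have hrest : X - ι₁.toLinearMap ∘ₗ d ∘ₗ π₁.toLinearMap ∈ Z₀ := by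
        refine Submodule.mem_inf.2 ⟨Submodule.sub_mem _ hX (h𝔡₁𝔞 d hd), ?_⟩
        rw [LinearMap.mem_ker, map_sub, hXcd, hr₁c₁, sub_self]
      have heq : X = ι₁.toLinearMap ∘ₗ d ∘ₗ π₁.toLinearMap + (X - ι₁.toLinearMap ∘ₗ d ∘ₗ π₁.toLinearMap) := by abel
      rw [heq]
      exact Submodule.add_mem _ (Submodule.mem_sup_left (Submodule.mem_sup_right ⟨d, hd, rfl⟩)) (Submodule.mem_sup_right hrest)
  -- (4) the Hodge operator `Θ ∈ 𝔞_ℂ` and its blocks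
  obtain ⟨Θ, hΘmem, hΘ⟩ := hΘex
  have hι₁F : ∀ p, ∀ x ∈ H₁.piece p (n - p), ι₁.toLinearMap.baseChange ℂ x ∈ H.piece p (n - p) :=
    fun p x hx => ι₁.map_piece_le p _ ⟨x, hx, rfl⟩
  have hι₂F : ∀ p, ∀ x ∈ H₂.piece p (n - p), ι₂.toLinearMap.baseChange ℂ x ∈ H.piece p (n - p) :=
    fun p x hx => ι₂.map_piece_le p _ ⟨x, hx, rfl⟩
  have hΘι₁ := theta_incl_eq H H₁ hι₁F hΘ hΘ₁
  have hΘι₂ := theta_incl_eq H H₂ hι₂F hΘ hΘ₂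
  have hrΘ₁ : π₁.toLinearMap.baseChange ℂ ∘ₗ Θ ∘ₗ ι₁.toLinearMap.baseChange ℂ = Θ₁ := by
    refine LinearMap.ext fun x => ?_
    rw [LinearMap.comp_apply, LinearMap.comp_apply, hΘι₁, proj_incl_baseChange hπι₁']
  have hrΘ₂ : π₂.toLinearMap.baseChange ℂ ∘ₗ Θ ∘ₗ ι₂.toLinearMap.baseChange ℂ = Θ₂ := by
    refine LinearMap.ext fun x => ?_
    rw [LinearMap.comp_apply, LinearMap.comp_apply, hΘι₂, proj_incl_baseChange hπι₂']
  -- the complex block maps and the trace functional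
  let r₁ : Module.End ℂ (ℂ ⊗[ℚ] V) →ₗ[ℂ] Module.End ℂ (ℂ ⊗[ℚ] V₁) :=
    (LinearMap.llcomp ℂ _ _ _ (π₁.toLinearMap.baseChange ℂ)).comp (LinearMap.lcomp ℂ _ (ι₁.toLinearMap.baseChange ℂ))
  let r₂ : Module.End ℂ (ℂ ⊗[ℚ] V) →ₗ[ℂ] Module.End ℂ (ℂ ⊗[ℚ] V₂) :=
    (LinearMap.llcomp ℂ _ _ _ (π₂.toLinearMap.baseChange ℂ)).comp (LinearMap.lcomp ℂ _ (ι₂.toLinearMap.baseChange ℂ))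
  have hr₂ : ∀ Z, r₂ Z = π₂.toLinearMap.baseChange ℂ ∘ₗ Z ∘ₗ ι₂.toLinearMap.baseChange ℂ := fun Z => rfl
  have hr₂bc : ∀ X : Module.End ℚ V, r₂ (X.baseChange ℂ) = (π₂.toLinearMap ∘ₗ X ∘ₗ ι₂.toLinearMap).baseChange ℂ := fun X => by
    rw [hr₂, ← LinearMap.baseChange_comp, ← LinearMap.baseChange_comp]
  let ℓ₁ : Module.End ℂ (ℂ ⊗[ℚ] V) →ₗ[ℂ] ℂ := (LinearMap.trace ℂ _).comp ((LinearMap.mulRight ℂ (φ₁.baseChange ℂ)).comp r₁)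
  have hℓ₁ : ∀ Z, ℓ₁ Z = LinearMap.trace ℂ _ ((π₁.toLinearMap.baseChange ℂ ∘ₗ Z ∘ₗ ι₁.toLinearMap.baseChange ℂ) * φ₁.baseChange ℂ) :=
    fun Z => rfl
  have hℓ₁Q : ∀ X : Module.End ℚ V, ℓ₁ (X.baseChange ℂ) =
      ((LinearMap.trace ℚ V₁ ((π₁.toLinearMap ∘ₗ X ∘ₗ ι₁.toLinearMap) * φ₁) : ℚ) : ℂ) := fun X => by
    rw [hℓ₁, ← LinearMap.baseChange_comp, ← LinearMap.baseChange_comp, ← LinearMap.baseChange_mul, LinearMap.trace_baseChange,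
      eq_ratCast]
  -- `ℓ₁` kills `D_ℂ` and `Z₀,ℂ`; `r₂` kills `D_ℂ` and maps `Z₀,ℂ` into `K_ℂ`
  have hCℓ₁D : ∀ s ∈ spanC D, ℓ₁ s = 0 := fun s hs => (Submodule.mem_bot ℂ).1 (map_spanC_mem_tr D ℓ₁ ⊥ (by
    rintro _ ⟨d, hd, rfl⟩
    rw [Submodule.mem_bot, hℓ₁Q, ← hr₁Q, hc₁, hr₁c₁, trace_mul_eq_zero_of_mem_derived_of_mem_endAlg hφ₁E hd, Rat.cast_zero]) s hs)
  have hCr₂D : ∀ s ∈ spanC D, r₂ s = 0 := fun s hs => (Submodule.mem_bot ℂ).1 (map_spanC_mem_tr D r₂ ⊥ (by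
    rintro _ ⟨d, hd, rfl⟩
    rw [Submodule.mem_bot, hr₂bc, ← hr₂Q, hc₁, hr₂c₁, LinearMap.baseChange_zero]) s hs)
  have hCℓ₁Z : ∀ k ∈ spanC Z₀, ℓ₁ k = 0 := fun k hk => (Submodule.mem_bot ℂ).1 (map_spanC_mem_tr Z₀ ℓ₁ ⊥ (fun z hz => by
    rw [Submodule.mem_bot, hℓ₁Q, hZ₀1 z hz, zero_mul, map_zero, Rat.cast_zero]) k hk)
  have hCr₂Z : ∀ k ∈ spanC Z₀, r₂ k ∈ spanC K := map_spanC_mem_tr Z₀ r₂ (spanC K) fun z hz => by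
    rw [hr₂bc]; exact baseChange_mem_spanC (Submodule.mem_map_of_mem (f := r₂Q) hz)
  -- `Θ = λ z₀,ℂ + s + k`
  have hΘmem' : Θ ∈ ((ℂ ∙ z₀.baseChange ℂ) ⊔ spanC D) ⊔ spanC Z₀ :=
    (sup_le_sup_right ((spanC_sup_le_tr _ _).trans (sup_le_sup_right (spanC_span_singleton_le_tr z₀) _)) _)
      (spanC_sup_le_tr _ _ (spanC_mono hle (show Θ ∈ spanC 𝔞 from hΘmem)))
  obtain ⟨as, has, k, hk, hask⟩ := Submodule.mem_sup.1 hΘmem'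
  obtain ⟨a, ha, s, hs, rfl⟩ := Submodule.mem_sup.1 has
  obtain ⟨lam, rfl⟩ := Submodule.mem_span_singleton.1 ha
  -- the trace identity `tr(Θ₁ φ₁) = λ x₀ tr(φ₁²)`
  have htr : LinearMap.trace ℂ _ (Θ₁ * φ₁.baseChange ℂ) = lam * x₀ * ((LinearMap.trace ℚ V₁ (φ₁ * φ₁) : ℚ) : ℂ) := by
    have h := congrArg ℓ₁ hask
    rw [map_add, map_add, map_smul, hCℓ₁D s hs, hCℓ₁Z k hk, add_zero, add_zero, hℓ₁Q, hx₀, smul_mul_assoc, map_smul,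
      smul_eq_mul, smul_eq_mul, Rat.cast_mul, hℓ₁, hrΘ₁] at h
    rw [← h]
    ring
  -- the block identity `Θ₂ − λ x₀ (y₀)_ℂ ∈ K_ℂ`
  have hblk : Θ₂ - (lam * x₀) • y₀.baseChange ℂ ∈ spanC K := by
    have h := congrArg r₂ hask
    rw [map_add, map_add, map_smul, hCr₂D s hs, add_zero, hr₂bc, hxy₀, baseChange_ratCast_smul_tr, smul_smul, hr₂ Θ, hrΘ₂] at h
    rw [← show r₂ k = Θ₂ - (lam * x₀) • y₀.baseChange ℂ by rw [← h, add_sub_cancel_left]]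
    exact hCr₂Z k hk
  -- the resonance, hence `𝔥(H₂) ≤ K`
  have hres : ((LinearMap.trace ℚ V₁ (φ₁ * φ₁) : ℚ) : ℂ) • Θ₂ - LinearMap.trace ℂ _ (Θ₁ * φ₁.baseChange ℂ) • y₀.baseChange ℂ ∈
      spanC K := by
    have heq : ((LinearMap.trace ℚ V₁ (φ₁ * φ₁) : ℚ) : ℂ) • Θ₂ - LinearMap.trace ℂ _ (Θ₁ * φ₁.baseChange ℂ) • y₀.baseChange ℂ =
        ((LinearMap.trace ℚ V₁ (φ₁ * φ₁) : ℚ) : ℂ) • (Θ₂ - (lam * x₀) • y₀.baseChange ℂ) := by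
      rw [htr, smul_sub, smul_smul]
      congr 2
      ring
    rw [heq]
    exact Submodule.smul_mem _ _ hblk
  have hK : H₂.hodgeLie ≤ K := hrig K hK𝔥 y₀ hy₀ hres
  -- (5) second corners lie in `𝔞`
  have hcorner₂ : ∀ y ∈ H₂.hodgeLie, ι₂.toLinearMap ∘ₗ y ∘ₗ π₂.toLinearMap ∈ 𝔞 := by
    intro y hy
    obtain ⟨z, hz, hzy⟩ := Submodule.mem_map.1 (hK hy)
    rw [hr₂Q] at hzy
    have hzeq := eq_corner₂_of_restrict₁_eq_zero ι₁ π₁ ι₂ π₂ hπι₁ hπι₂ hsum (h𝔞 (hZ₀𝔞 hz)) (hZ₀1 z hz)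
    rw [hzy] at hzeq
    rw [← hzeq]
    exact hZ₀𝔞 hz
  -- conclusion
  intro X hX
  have hx : π₁.toLinearMap ∘ₗ X ∘ₗ ι₁.toLinearMap ∈ H₁.hodgeLie := comp_mem_hodgeLie_of_retract ι₁ π₁ hπι₁ hX
  obtain ⟨X', hX', hX'x⟩ := hlift _ hx
  rw [hr₁Q] at hX'x
  have hsX := eq_sum_blocks_of_mem_hodgeLie ι₁ π₁ ι₂ π₂ hπι₁ hπι₂ hsum hX
  have hsX' := eq_sum_blocks_of_mem_hodgeLie ι₁ π₁ ι₂ π₂ hπι₁ hπι₂ hsum (h𝔞 hX')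
  rw [hX'x] at hsX'
  have hA : ι₁.toLinearMap ∘ₗ (π₁.toLinearMap ∘ₗ X ∘ₗ ι₁.toLinearMap) ∘ₗ π₁.toLinearMap =
      X - ι₂.toLinearMap ∘ₗ (π₂.toLinearMap ∘ₗ X ∘ₗ ι₂.toLinearMap) ∘ₗ π₂.toLinearMap := by
    rw [eq_sub_iff_add_eq]; exact hsX.symm
  have hB : ι₁.toLinearMap ∘ₗ (π₁.toLinearMap ∘ₗ X ∘ₗ ι₁.toLinearMap) ∘ₗ π₁.toLinearMap =
      X' - ι₂.toLinearMap ∘ₗ (π₂.toLinearMap ∘ₗ X' ∘ₗ ι₂.toLinearMap) ∘ₗ π₂.toLinearMap := by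
    rw [eq_sub_iff_add_eq]; exact hsX'.symm
  have heq : X = X' - ι₂.toLinearMap ∘ₗ (π₂.toLinearMap ∘ₗ X' ∘ₗ ι₂.toLinearMap) ∘ₗ π₂.toLinearMap +
      ι₂.toLinearMap ∘ₗ (π₂.toLinearMap ∘ₗ X ∘ₗ ι₂.toLinearMap) ∘ₗ π₂.toLinearMap := by
    rw [← hB, hA, sub_add_cancel]
  rw [heq]
  exact Submodule.add_mem _ (Submodule.sub_mem _ hX' (hcorner₂ _ (comp_mem_hodgeLie_of_retract ι₂ π₂ hπι₂ (h𝔞 hX'))))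
    (hcorner₂ _ (comp_mem_hodgeLie_of_retract ι₂ π₂ hπι₂ hX))

end Main

/-! ## §2 The absorbed case: `dim 𝔥(H) ≤ dim 𝔥(H₁)` -/

include hπι₁ hrig₁ in
/-- **`Θ`-rigidity of an absorbed product.**  If `H₁` is `Θ`-rigid and `dim_ℚ 𝔥(H) ≤ dim_ℚ 𝔥(H₁)` — so the restriction `r₁ : 𝔥(H) → 𝔥(H₁)`,
which is onto by rigidity (`hodgeLie_eq_map_restrict_of_rigid`), is a bijection: `Hg(X₁ × X₂) ≅ Hg(X₁)` — then `H` is `Θ`-rigid: for a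
bracket-closed `𝔞 ⊆ 𝔥(H)` with a Hodge operator in `𝔞 ⊗ ℂ`, `r₁(𝔞) = 𝔥(H₁)` (`map_restrict_eq_hodgeLie_of_rigid`) forces
`dim 𝔞 ≥ dim 𝔥(H₁) ≥ dim 𝔥(H)`.  (E.g. `X₁ × E`, `E` a CM elliptic curve with `End⁰E ≅ End⁰X₁ = k` and `t(X₁ × E) = t(X₁)`: Moonen–Zarhin
(0.1)(4)(a).) [cite: MoonenZarhin1999LowDim, §3 (3.1)] [cite: Deligne1982HodgeCycles, I §3.1 and Prop. 3.4] -/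
theorem rigid_of_rigid_of_finrank_le (hfin : Module.finrank ℚ H.hodgeLie ≤ Module.finrank ℚ H₁.hodgeLie) :
    ∀ 𝔞 : Submodule ℚ (Module.End ℚ V), 𝔞 ≤ H.hodgeLie →
      (∀ X ∈ 𝔞, ∀ Y ∈ 𝔞, X * Y - Y * X ∈ 𝔞) →
      (∃ Θ ∈ Submodule.span ℂ ((fun X : Module.End ℚ V => X.baseChange ℂ) '' (𝔞 : Set (Module.End ℚ V))),
        ∀ p, ∀ x ∈ H.piece p (n - p), Θ x = ((2 * p - n : ℤ) : ℂ) • x) → H.hodgeLie ≤ 𝔞 := by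
  intro 𝔞 h𝔞 hbr hΘex
  set r₁Q : Module.End ℚ V →ₗ[ℚ] Module.End ℚ V₁ :=
    (LinearMap.llcomp ℚ V₁ V V₁ π₁.toLinearMap).comp (LinearMap.lcomp ℚ V ι₁.toLinearMap) with hr₁Qdef
  have himg : 𝔞.map r₁Q = H₁.hodgeLie := map_restrict_eq_hodgeLie_of_rigid ι₁ π₁ hπι₁ hrig₁ 𝔞 h𝔞 hbr hΘex
  have h1 : Module.finrank ℚ H₁.hodgeLie ≤ Module.finrank ℚ 𝔞 := by
    rw [← himg]
    exact Submodule.finrank_map_le r₁Q 𝔞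
  exact (Submodule.eq_of_le_of_finrank_le h𝔞 (hfin.trans h1)).ge

end HodgeStructure

end Literature.AlgebraicGeometry.Motives

end
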